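import Mathlib
import HarnessLib
import Summits.QuantumFields.YangMills.Theses.LangevinControlUV

/-!
# Sketch (crux-ideate, ideator 1, round 1) — first lemmas for crux `FemtoCurvatureSkewness`
(stmt-QuantumFields-9365, decl `Summit.QuantumFields.YangMills.Theses.LangevinControlUV.FemtoCurvatureSkewness`)

Cards: `skeleton-ratio` (C⁺ = `SkewRatioLowerBound`, transfer algebra `ratio_transfer_real` PROVED,
transfer `skewness_of_ratio` stated), `toron-conditioning` (first lemmas `ToronBlindTriangleTree`,
`PerpendicularTrianglePositiveTree`, `TotalCumulance`) and `corner-size-bias` (`triangleCum_sizeBias` PROVED,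
C⁺ `SizeBiasMonotoneAt`). The package/conclusion unbundling
`femtoCurvatureSkewness_iff` is by `Iff.rfl`.
-/

noncomputable section

open scoped BigOperators
open MeasureTheory Filter Topology

namespace Summit.QuantumFields.YangMills.Cruxes.FemtoCurvatureSkewness.Ideator1

open Literature.MathematicalPhysics.QuantumFieldTheory
open Summit.QuantumFields.YangMills.Theses.LangevinControlUV (FemtoCurvatureSkewness)

section Defs

variable {G : Type} [Group G] [TopologicalSpace G] [IsTopologicalGroup G] [CompactSpace G]
  [MeasurableSpace G] [BorelSpace G] {N : ℕ}

/-- The plaquette field `P_x^{ij}(U) = N − Re tr ρ(U_{p(x;i,j)})` (the crux's `let P`). -/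
def plaq (ρ : G →* Matrix (Fin N) (Fin N) ℂ) {L : ℕ} (x : Fin 4 → ZMod L) (i j : Fin 4)
    (U : GaugeConfig 4 L G) : ℝ :=
  (N : ℝ) - (ρ (plaquetteHolonomy U x i j)).trace.re

/-- Wilson expectation (the crux's `let E`). -/
def wE (ρ : G →* Matrix (Fin N) (Fin N) ℂ) {L : ℕ} [NeZero L] (β : ℝ)
    (F : GaugeConfig 4 L G → ℝ) : ℝ :=
  wilsonExpectation (d := 4) (L := L) ρ β F

/-- Covariance (the crux's `let cov`). -/
def cov (ρ : G →* Matrix (Fin N) (Fin N) ℂ) {L : ℕ} [NeZero L] (β : ℝ)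
    (F F' : GaugeConfig 4 L G → ℝ) : ℝ :=
  wE ρ β (fun U => F U * F' U) - wE ρ β F * wE ρ β F'

/-- Third joint cumulant `E[F̂ F̂' F̂'']`, written term by term as in the crux. -/
def cum3 (ρ : G →* Matrix (Fin N) (Fin N) ℂ) {L : ℕ} [NeZero L] (β : ℝ)
    (F F' F'' : GaugeConfig 4 L G → ℝ) : ℝ :=
  wE ρ β (fun U => F U * F' U * F'' U) - wE ρ β F * cov ρ β F' F'' - wE ρ β F' * cov ρ β F F''
    - wE ρ β F'' * cov ρ β F F' - wE ρ β F * wE ρ β F' * wE ρ β F''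

/-- Torus Euclidean distance (the crux's `let dist`). -/
def tdist {L : ℕ} (x y : Fin 4 → ZMod L) : ℝ :=
  Real.sqrt (∑ k : Fin 4, (((x k - y k).valMinAbs : ℤ) : ℝ) ^ 2)

/-- The site `n e_k`. -/
def axisSite (L : ℕ) (k : Fin 4) (n : ℕ) : Fin 4 → ZMod L := Pi.single k ((n : ℕ) : ZMod L)

/-- The reference axis covariance `Cov(P_0^{01}, P_{ne₂}^{01})`. -/
def axisCov (ρ : G →* Matrix (Fin N) (Fin N) ℂ) (L : ℕ) [NeZero L] (β : ℝ) (n : ℕ) : ℝ :=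
  cov ρ β (plaq ρ 0 0 1) (plaq ρ (axisSite L 2 n) 0 1)

/-- The crux's triangle cumulant `κ₃(P_0^{01}, P_{ne₂}^{01}, P_{ne₃}^{01})`. -/
def triangleCum (ρ : G →* Matrix (Fin N) (Fin N) ℂ) (L : ℕ) [NeZero L] (β : ℝ) (n : ℕ) : ℝ :=
  cum3 ρ β (plaq ρ 0 0 1) (plaq ρ (axisSite L 2 n) 0 1) (plaq ρ (axisSite L 3 n) 0 1)

/-- The two-point package clauses on one torus at one coupling (crux HYPOTHESIS at fixed `a`;
same shape as the sibling disprover's `FemtoCurvatureTwoPoint.Disproof.Clauses`). -/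
def Clauses (ρ : G →* Matrix (Fin N) (Fin N) ℂ) (a Γ : ℝ → ℝ) (c C : ℝ) (L : ℕ) [NeZero L]
    (β : ℝ) : Prop :=
  (∀ n : ℕ, 1 ≤ n → 8 * n ≤ L →
      c * Γ ((n : ℝ) * a β) ≤ (n : ℝ) ^ 8 * axisCov ρ L β n ∧
        (n : ℝ) ^ 8 * axisCov ρ L β n ≤ C * Γ ((n : ℝ) * a β)) ∧
    ∀ (x y : Fin 4 → ZMod L) (i j i' j' : Fin 4), x ≠ y → i ≠ j → i' ≠ j' →
      |cov ρ β (plaq ρ x i j) (plaq ρ y i' j')| * tdist x y ^ 8 ≤ C * Γ (tdist x y * a β)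

/-- The package with explicit data `(a, Γ, β₀, ℓ₀, c, C)`. -/
def PackageWith (ρ : G →* Matrix (Fin N) (Fin N) ℂ) (a Γ : ℝ → ℝ) (β₀ ℓ₀ c C : ℝ) : Prop :=
  0 < ℓ₀ ∧ 0 < c ∧ (∀ β, 0 < a β) ∧ Tendsto a atTop (𝓝 0) ∧
    (∀ s : ℝ, 0 < s → s ≤ ℓ₀ → 0 < Γ s ∧ Γ s ≤ 1) ∧
      ∀ (L : ℕ) [NeZero L] (β : ℝ), β₀ ≤ β → (L : ℝ) * a β ≤ ℓ₀ → Clauses ρ a Γ c C L β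

/-- The crux CONCLUSION at a fixed unit map `a` (skewness lower bound with a free shape `Γ₃`). -/
def SkewConclusion (ρ : G →* Matrix (Fin N) (Fin N) ℂ) (a : ℝ → ℝ) : Prop :=
  ∃ (Γ₃ : ℝ → ℝ) (β₁ ℓ₁ c₃ : ℝ), 0 < ℓ₁ ∧ 0 < c₃ ∧ (∀ s : ℝ, 0 < s → s ≤ ℓ₁ → 0 < Γ₃ s) ∧
    ∀ (L : ℕ) [NeZero L] (β : ℝ), β₁ ≤ β → (L : ℝ) * a β ≤ ℓ₁ →
      ∀ n : ℕ, 1 ≤ n → 8 * n ≤ L →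
        c₃ * Γ₃ ((n : ℝ) * a β) ≤ (n : ℝ) ^ 12 * |triangleCum ρ L β n|

/-- **C⁺ of card `skeleton-ratio` at fixed data**: the scale-free skewness ratio
`ρ := κ₃ / Cov(P_0^{01},P_{ne₂}^{01})^{3/2}` is bounded below by `ρ₀ > 0` on `a`'s femto regime —
equivalently the third-order skeleton inequality `ρ₀ · G̃³ ≤ κ₃` with the gauge-invariant effective
propagator `G̃ := Cov^{1/2}` read off the FULL two-point function (tree value of `ρ·√dim G`: 0.816 at
`n = 1`, `→ 1/√2` as `n → ∞`; no unit map, no `Γ`, no `Z`-factor appears). -/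
def SkewRatioAt (ρ : G →* Matrix (Fin N) (Fin N) ℂ) (a : ℝ → ℝ) : Prop :=
  ∃ (β₁ ℓ₁ ρ₀ : ℝ), 0 < ℓ₁ ∧ 0 < ρ₀ ∧
    ∀ (L : ℕ) [NeZero L] (β : ℝ), β₁ ≤ β → (L : ℝ) * a β ≤ ℓ₁ →
      ∀ n : ℕ, 1 ≤ n → 8 * n ≤ L →
        ρ₀ * (axisCov ρ L β n * Real.sqrt (axisCov ρ L β n)) ≤ triangleCum ρ L β n

end Defs

/-- Unbundling: the crux is `∀ G simple compact, ∀ r a, (∃ data, PackageWith) → SkewConclusion`. -/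
theorem femtoCurvatureSkewness_iff :
    FemtoCurvatureSkewness ↔
      ∀ (G : Type) [Group G] [TopologicalSpace G] [IsTopologicalGroup G] [CompactSpace G],
        IsCompactSimpleLieGroup G →
          letI : MeasurableSpace G := borel G
          haveI : BorelSpace G := ⟨rfl⟩
          ∀ (r : LatticeRep G) (a : ℝ → ℝ),
            (∃ (Γ : ℝ → ℝ) (β₀ ℓ₀ c C : ℝ), PackageWith r.ρ a Γ β₀ ℓ₀ c C) → SkewConclusion r.ρ a :=
  Iff.rfl

/-- **C⁺ (card `skeleton-ratio`).** Same quantifier shell as the crux; conclusion = skeleton ratio bound. -/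
def SkewRatioLowerBound : Prop :=
  ∀ (G : Type) [Group G] [TopologicalSpace G] [IsTopologicalGroup G] [CompactSpace G],
    IsCompactSimpleLieGroup G →
      letI : MeasurableSpace G := borel G
      haveI : BorelSpace G := ⟨rfl⟩
      ∀ (r : LatticeRep G) (a : ℝ → ℝ),
        (∃ (Γ : ℝ → ℝ) (β₀ ℓ₀ c C : ℝ), PackageWith r.ρ a Γ β₀ ℓ₀ c C) → SkewRatioAt r.ρ a

/-- **The transfer algebra (PROVED): `Γ₃ := Γ^{3/2}`.** From the package's axis lower clause
`c·Γ ≤ n⁸·Cov` and the ratio bound `ρ₀·Cov^{3/2} ≤ κ₃` we get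
`(ρ₀ c^{3/2})·Γ^{3/2} ≤ n¹²·|κ₃|` — the crux's conclusion at that configuration. -/
theorem ratio_transfer_real {c Γs cv k3 ρ₀ : ℝ} {n : ℕ} (hc : 0 ≤ c) (hΓ : 0 ≤ Γs) (hρ : 0 ≤ ρ₀)
    (h2 : c * Γs ≤ (n : ℝ) ^ 8 * cv) (h3 : ρ₀ * (cv * Real.sqrt cv) ≤ k3) :
    ρ₀ * (c * Real.sqrt c) * (Γs * Real.sqrt Γs) ≤ (n : ℝ) ^ 12 * |k3| := by
  have hX : 0 ≤ c * Γs := mul_nonneg hc hΓ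
  have hn8 : (0 : ℝ) ≤ (n : ℝ) ^ 8 := by positivity
  have hsq8 : Real.sqrt ((n : ℝ) ^ 8) = (n : ℝ) ^ 4 := by
    rw [show ((n : ℝ) ^ 8) = ((n : ℝ) ^ 4) ^ 2 by ring, Real.sqrt_sq (by positivity)]
  have h1 : (c * Γs) * Real.sqrt (c * Γs) ≤ ((n : ℝ) ^ 8 * cv) * Real.sqrt ((n : ℝ) ^ 8 * cv) :=
    mul_le_mul h2 (Real.sqrt_le_sqrt h2) (Real.sqrt_nonneg _) (hX.trans h2)
  have e1 : Real.sqrt (c * Γs) = Real.sqrt c * Real.sqrt Γs := Real.sqrt_mul hc Γs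
  have e2 : Real.sqrt ((n : ℝ) ^ 8 * cv) = (n : ℝ) ^ 4 * Real.sqrt cv := by
    rw [Real.sqrt_mul hn8, hsq8]
  rw [e1, e2] at h1
  have h4 : ρ₀ * ((c * Γs) * (Real.sqrt c * Real.sqrt Γs)) ≤
      ρ₀ * (((n : ℝ) ^ 8 * cv) * ((n : ℝ) ^ 4 * Real.sqrt cv)) :=
    mul_le_mul_of_nonneg_left h1 hρ
  have h6 : (n : ℝ) ^ 12 * (ρ₀ * (cv * Real.sqrt cv)) ≤ (n : ℝ) ^ 12 * |k3| :=
    mul_le_mul_of_nonneg_left (h3.trans (le_abs_self k3)) (by positivity)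
  calc ρ₀ * (c * Real.sqrt c) * (Γs * Real.sqrt Γs)
        = ρ₀ * ((c * Γs) * (Real.sqrt c * Real.sqrt Γs)) := by ring
    _ ≤ ρ₀ * (((n : ℝ) ^ 8 * cv) * ((n : ℝ) ^ 4 * Real.sqrt cv)) := h4
    _ = (n : ℝ) ^ 12 * (ρ₀ * (cv * Real.sqrt cv)) := by ring
    _ ≤ (n : ℝ) ^ 12 * |k3| := h6

/-- **Transfer at fixed data (card `skeleton-ratio`)**: package ∧ ratio bound ⇒ the crux conclusion,
with `Γ₃ := Γ · √Γ`, `c₃ := ρ₀ c √c`, `β₁ := max β₀ β₁'`, `ℓ₁ := min ℓ₀ ℓ₁'` (bookkeeping over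
`ratio_transfer_real`; positivity of `Γ₃` on `(0, ℓ₁]` from `0 < Γ ≤ 1` on `(0, ℓ₀]`). -/
theorem skewConclusion_of_ratio {G : Type} [Group G] [TopologicalSpace G] [IsTopologicalGroup G]
    [CompactSpace G] [MeasurableSpace G] [BorelSpace G] {N : ℕ} (ρ : G →* Matrix (Fin N) (Fin N) ℂ)
    (a Γ : ℝ → ℝ) (β₀ ℓ₀ c C : ℝ) (hP : PackageWith ρ a Γ β₀ ℓ₀ c C) (hR : SkewRatioAt ρ a) :
    SkewConclusion ρ a := by
  sorry

/-- **Transfer (card `skeleton-ratio`)**: `C⁺ ⇒ crux`. -/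
theorem skewness_of_ratio (h : SkewRatioLowerBound) : FemtoCurvatureSkewness := by
  sorry

/-! ## Card `toron-conditioning` — first lemmas -/

open Classical in
/-- The free lattice field-strength kernel of the `01`-plaquette field on `(ℤ/L)⁴` in a CONSTANT abelian
background (toron proxy): momenta shifted by `θ/L`; at `θ = 0` the zero mode is dropped.
`G_{L,θ}(u) = L⁻⁴ Σ_k (ŝ₀²+ŝ₁²)/ŝ² · e^{i k·u}`, `k_μ = 2πm_μ/L + θ_μ/L`, `ŝ_μ = 2 sin(k_μ/2)`. -/
def twistedKernel (L : ℕ) [NeZero L] (θ : Fin 4 → ℝ) (u : Fin 4 → ℤ) : ℂ :=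
  (1 / (L : ℂ) ^ 4) * ∑ m : Fin 4 → Fin L,
    if (θ = 0 ∧ m = 0) then 0 else
      (((4 * Real.sin ((2 * Real.pi * ((m 0 : ℕ) : ℝ) / L + θ 0 / L) / 2) ^ 2
          + 4 * Real.sin ((2 * Real.pi * ((m 1 : ℕ) : ℝ) / L + θ 1 / L) / 2) ^ 2) /
          (∑ μ : Fin 4, 4 * Real.sin ((2 * Real.pi * ((m μ : ℕ) : ℝ) / L + θ μ / L) / 2) ^ 2) : ℝ) : ℂ) *
        Complex.exp (Complex.I *
          ((∑ μ : Fin 4, (2 * Real.pi * ((m μ : ℕ) : ℝ) / L + θ μ / L) * ((u μ : ℤ) : ℝ) : ℝ) : ℂ))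

/-- **First lemma of card `toron-conditioning` (tree level; numerically certified, see the card):**
for `1 ≤ n ≤ L/8` the CLOSED triangle product of kernels `0 → ne₂ → ne₃ → 0` is insensitive to any
constant abelian background to within 10 % (observed ≤ 2.2 %, worst case an in-plane twist `θ₀ = π`
on `L = 8`; Poisson summation: the direct term is `θ`-free, images are `(n/L)⁴`-suppressed). In
particular the toron average cannot flip the tree-level sign of `κ₃`. -/
def ToronBlindTriangleTree : Prop :=
  ∀ (L : ℕ) [NeZero L] (n : ℕ), 1 ≤ n → 8 * n ≤ L → ∀ θ : Fin 4 → ℝ,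
    let e₂ : Fin 4 → ℤ := Pi.single 2 (n : ℤ)
    let e₃ : Fin 4 → ℤ := Pi.single 3 (n : ℤ)
    let prod : (Fin 4 → ℝ) → ℂ := fun θ' =>
      twistedKernel L θ' e₂ * twistedKernel L θ' (e₃ - e₂) * twistedKernel L θ' (-e₃)
    ‖prod θ - prod 0‖ ≤ (1 / 10) * ‖prod 0‖

/-- **Tree-level positivity of the perpendicular triangle (certified numerically for `L ≤ 64`):**
the three kernels on the sides of the crux triangle are real and POSITIVE (`π²n⁴G(ne₂) ∈ [0.68, 1.81]`,
`4π²n⁴G(n(e₂−e₃)) ∈ [0.78, 1.20]`), so the Isserlis cycle `8·dim G·G₁₂G₂₃G₃₁` is positive and the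
scale-free ratio `ρ·√dim G = 2√2·G(n(e₂−e₃))/G(ne₂)` lies in `[0.48, 0.82]` for `1 ≤ n ≤ L/8`. -/
def PerpendicularTrianglePositiveTree : Prop :=
  ∀ (L : ℕ) [NeZero L] (n : ℕ), 1 ≤ n → 8 * n ≤ L →
    0 < (twistedKernel L 0 (Pi.single 2 (n : ℤ))).re ∧
      0 < (twistedKernel L 0 (Pi.single 2 (n : ℤ) - Pi.single 3 (n : ℤ))).re ∧
        (2 / 5 : ℝ) ≤ 2 * Real.sqrt 2 *
            (twistedKernel L 0 (Pi.single 2 (n : ℤ) - Pi.single 3 (n : ℤ))).re /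
              (twistedKernel L 0 (Pi.single 2 (n : ℤ))).re

/-- **Law of total cumulance (Brillinger 1969), the disintegration step of card
`toron-conditioning`**, for a probability measure, bounded measurable `X Y Z` and ANY sub-σ-algebra
`m` (the card uses `m` = σ(Polyakov holonomies) = the toron sector): with `d F := F − E[F|m]` and
`e F := E[F|m] − E F`,
`E[X̂ŶẐ] = E[dX dY dZ] + Σ_{cyc} E[eX · E[dY dZ | m]] + E[eX eY eZ]`
(the terms with exactly one `d` vanish by the tower property). Provable now from Mathlib's `condExp`. -/
def TotalCumulance : Prop :=
  ∀ {Ω : Type} {m m0 : MeasurableSpace Ω} (μ : Measure Ω) [IsProbabilityMeasure μ], m ≤ m0 →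
    ∀ (X Y Z : Ω → ℝ), Measurable X → Measurable Y → Measurable Z →
      (∃ B : ℝ, ∀ ω, |X ω| ≤ B ∧ |Y ω| ≤ B ∧ |Z ω| ≤ B) →
        let c : (Ω → ℝ) → Ω → ℝ := fun F ω => F ω - ∫ ω', F ω' ∂μ
        let d : (Ω → ℝ) → Ω → ℝ := fun F ω => F ω - (μ[F|m]) ω
        let e : (Ω → ℝ) → Ω → ℝ := fun F ω => (μ[F|m]) ω - ∫ ω', F ω' ∂μ
        ∫ ω, c X ω * c Y ω * c Z ω ∂μ =
          ∫ ω, d X ω * d Y ω * d Z ω ∂μ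
            + ∫ ω, e X ω * (μ[fun ω' => d Y ω' * d Z ω'|m]) ω ∂μ
            + ∫ ω, e Y ω * (μ[fun ω' => d X ω' * d Z ω'|m]) ω ∂μ
            + ∫ ω, e Z ω * (μ[fun ω' => d X ω' * d Y ω'|m]) ω ∂μ
            + ∫ ω, e X ω * e Y ω * e Z ω ∂μ


/-! ## Card `corner-size-bias` — first lemmas -/

section SizeBias

variable {G : Type} [Group G] [TopologicalSpace G] [IsTopologicalGroup G] [CompactSpace G]
  [MeasurableSpace G] [BorelSpace G] {N : ℕ}

/-- Covariance of `F', F''` under the measure SIZE-BIASED by the non-negative observable `F`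
(`dμ_F := F dμ / E F`), written with Wilson expectations only. -/
def sbCov (ρ : G →* Matrix (Fin N) (Fin N) ℂ) {L : ℕ} [NeZero L] (β : ℝ)
    (F F' F'' : GaugeConfig 4 L G → ℝ) : ℝ :=
  wE ρ β (fun U => F U * F' U * F'' U) / wE ρ β F
    - (wE ρ β (fun U => F U * F' U) / wE ρ β F) * (wE ρ β (fun U => F U * F'' U) / wE ρ β F)

/-- **The size-bias identity behind card `corner-size-bias` (pure algebra, PROVED):** for reals with
`E1 ≠ 0`, the third cumulant equals `E1 · (Cov_biased − Cov) + Cov₁₂·Cov₁₃/E1`. -/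
theorem cum3_sizeBias_real {E123 E12 E13 E23 E1 E2 E3 : ℝ} (h : E1 ≠ 0) :
    E123 - E1 * (E23 - E2 * E3) - E2 * (E13 - E1 * E3) - E3 * (E12 - E1 * E2) - E1 * E2 * E3
      = E1 * ((E123 / E1 - (E12 / E1) * (E13 / E1)) - (E23 - E2 * E3))
        + (E12 - E1 * E2) * (E13 - E1 * E3) / E1 := by
  field_simp
  ring

/-- **The crux's cumulant, size-biased by the corner plaquette (PROVED from the definitions):**
`κ₃(P₀,P₂,P₃) = E[P₀]·(Cov_{μ₀}(P₂,P₃) − Cov_μ(P₂,P₃)) + Cov(P₀,P₂)·Cov(P₀,P₃)/E[P₀]`, where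
`μ₀ := P₀ μ / E[P₀]` is a probability measure because `P₀ ≥ 0`. The last term is `≥ 0` by
reflection positivity (both factors are axis covariances of the reference pair up to the lattice
symmetry `e₂ ↔ e₃`), so `κ₃ ≥ E[P₀]·Δ`: the odd cumulant is bounded BELOW by the increase of an
even covariance under a positive local tilt. -/
theorem triangleCum_sizeBias (ρ : G →* Matrix (Fin N) (Fin N) ℂ) (L : ℕ) [NeZero L] (β : ℝ) (n : ℕ)
    (h : wE ρ β (plaq ρ (0 : Fin 4 → ZMod L) 0 1) ≠ 0) :
    triangleCum ρ L β n
      = wE ρ β (plaq ρ (0 : Fin 4 → ZMod L) 0 1) *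
          (sbCov ρ β (plaq ρ (0 : Fin 4 → ZMod L) 0 1) (plaq ρ (axisSite L 2 n) 0 1) (plaq ρ (axisSite L 3 n) 0 1)
            - cov ρ β (plaq ρ (axisSite L 2 n) 0 1) (plaq ρ (axisSite L 3 n) 0 1))
        + cov ρ β (plaq ρ (0 : Fin 4 → ZMod L) 0 1) (plaq ρ (axisSite L 2 n) 0 1)
            * cov ρ β (plaq ρ (0 : Fin 4 → ZMod L) 0 1) (plaq ρ (axisSite L 3 n) 0 1) / wE ρ β (plaq ρ (0 : Fin 4 → ZMod L) 0 1) := by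
  unfold triangleCum cum3 sbCov cov
  field_simp
  ring

/-- **C⁺ of card `corner-size-bias` at fixed data (size-bias monotonicity with a floor):** on `a`'s
femto regime, size-biasing Wilson's measure by the corner plaquette raises the covariance of the two
arm plaquettes by at least `ρ₀' · Cov(P₀,P_{ne₂})^{3/2} / E[P₀]`. With `triangleCum_sizeBias` and
`Cov(P₀,P_{ne₂}), Cov(P₀,P_{ne₃}) ≥ 0` (RP) this gives `SkewRatioAt` with `ρ₀ := ρ₀'`, hence the crux
by card skeleton-ratio's transfer. Tree value of the floor: `ρ₀'·√dim G ≈ 0.76 × 0.816` at `n = 1`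
(the dropped RP term is 24 % of `κ₃` there and `O(n⁻⁴)` beyond). -/
def SizeBiasMonotoneAt (ρ : G →* Matrix (Fin N) (Fin N) ℂ) (a : ℝ → ℝ) : Prop :=
  ∃ (β₁ ℓ₁ ρ₀' : ℝ), 0 < ℓ₁ ∧ 0 < ρ₀' ∧
    ∀ (L : ℕ) [NeZero L] (β : ℝ), β₁ ≤ β → (L : ℝ) * a β ≤ ℓ₁ →
      ∀ n : ℕ, 1 ≤ n → 8 * n ≤ L →
        0 < wE ρ β (plaq ρ (0 : Fin 4 → ZMod L) 0 1) ∧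
        ρ₀' * (axisCov ρ L β n * Real.sqrt (axisCov ρ L β n)) ≤
          wE ρ β (plaq ρ (0 : Fin 4 → ZMod L) 0 1) *
            (sbCov ρ β (plaq ρ (0 : Fin 4 → ZMod L) 0 1) (plaq ρ (axisSite L 2 n) 0 1) (plaq ρ (axisSite L 3 n) 0 1)
              - cov ρ β (plaq ρ (axisSite L 2 n) 0 1) (plaq ρ (axisSite L 3 n) 0 1))

/-- **RP input (provable now from the tree's `wilsonExpectation_reflectionPositive_holds` after an
axis relabelling; stated):** the two axis covariances of the corner with its arms are non-negative. -/
theorem armCov_nonneg (ρ : G →* Matrix (Fin N) (Fin N) ℂ) (hρ : Continuous ρ)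
    (hρu : ∀ g, ρ g ∈ Matrix.unitaryGroup (Fin N) ℂ) (L : ℕ) [NeZero L] {β : ℝ} (hβ : 0 ≤ β)
    (n : ℕ) :
    0 ≤ cov ρ β (plaq ρ (0 : Fin 4 → ZMod L) 0 1) (plaq ρ (axisSite L 2 n) 0 1) ∧
      0 ≤ cov ρ β (plaq ρ (0 : Fin 4 → ZMod L) 0 1) (plaq ρ (axisSite L 3 n) 0 1) := by
  sorry

/-- **Transfer of card `corner-size-bias` (stated): size-bias monotonicity ⇒ the skeleton ratio bound.** -/
theorem skewRatioAt_of_sizeBias (ρ : G →* Matrix (Fin N) (Fin N) ℂ) (hρ : Continuous ρ)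
    (hρu : ∀ g, ρ g ∈ Matrix.unitaryGroup (Fin N) ℂ) (a : ℝ → ℝ) (h : SizeBiasMonotoneAt ρ a) :
    SkewRatioAt ρ a := by
  sorry

end SizeBias

end Summit.QuantumFields.YangMills.Cruxes.FemtoCurvatureSkewness.Ideator1
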